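import Literature.AlgebraicGeometry.HodgeTheory.CMFieldSkewArithmetic
import Literature.AlgebraicGeometry.HodgeTheory.CMHodgeGroupLieSocket
import Literature.AlgebraicGeometry.HodgeTheory.CMHodgeGroupPowersHodgeClasses
import HarnessLib

/-!
# The centre of `Lie Hg` for a CM field `E = ℚ[φ]`: given the lifts of the `𝔰𝔩(W_σ)`, either the central idempotents
# lie in `𝔤_ℂ` or a non-zero `y ∈ E⁻` is trace-orthogonal to `𝔤` (Moonen–Zarhin 1999 §1–2, Ribet 1983 Thm. 0)

Family `hodge`, layer `Literature/AlgebraicGeometry/HodgeTheory` (brick P4 of the design note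
`HOME/jobs/A7-inventory-eng5g6/DESIGN-rows10-12-allmembers.md` of the cell `pub-hodgeav-hg6`, req-37 (A) Q2b, TABLE X rows
10 / 12 ALL MEMBERS). UNCONDITIONAL; theorems only, no definition, no named fact, no `sorry`. HONEST FRAMING of that cell:
HC / HC_AV / HC_CM / H2 NOT proved — this file is linear algebra of polarized weight-one `ℚ`-Hodge structures.

SETTING (as in `CMThetaSocket.mem_spanC_of_lift_of_centre`): `H` effective polarized of weight `1`, `E = End_Hdg(V) = ℚ[φ]`
(`hE`) commutative of dimension `2|ι|` with every non-zero element invertible (`hdiv`: `End⁰` of a simple abelian variety)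
and `φ† ≠ φ`; a CM type `μ : ι → ℂ` of `φ_ℂ` with all `W_c = ker(φ_ℂ − c)`, `c ∈ {μ k, conj μ k}`, of the same dimension `n₀`
and spanning `V_ℂ`; an admissible `𝔤 ⊆ End_ℚ(V)` (commuting with `E`, `ψ`-skew) with `Θ ∈ 𝔤_ℂ`; and the LIFT property
(every traceless endomorphism of `W_{μ k}` is induced by an element of `𝔤_ℂ` killing the other `W_{μ j}` — for `𝔤 = Lie Hg`
the output of bricks P1–P3).
* **`CMThetaCentre.centre_or_exists_skew`** — THE DICHOTOMY: either (CENTRE) for every `k` some `C ∈ 𝔤_ℂ` is `1` on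
  `W_{μ k}` and `0` on the other `W_{μ j}` (the remaining input of the socket, whence `𝔤_ℂ ⊇ 𝔲_E(V,ψ)_ℂ`), or there is a
  non-zero `ψ`-SKEW `y ∈ E` with `Σ_k σ_k(y) · (dim W_{μ k}^{1,0} − dim W_{μ k}^{0,1}) = 0`, `σ_k(y)` the scalar of `y_ℂ` on
  `W_{μ k}` — i.e. `Tr_V(y Θ) = 0`: `y` is trace-orthogonal to `𝔤 ∋ Θ`. PROOF (Galois-free): with the coordinate traces
  `trv_k(D) = tr(D|_{W_{μ k}})` (an adapted dual basis, `CMArith.*`), CENTRE follows from LIFT as soon as `trv(𝔤_ℂ) = ℂ^ι`;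
  the pairing `Σ_k σ_k(y) trv_k(X_ℂ) = ½ Tr_ℚ(y X)` is RATIONAL for `y` in a `ℚ`-basis `(y_i)` of `E⁻` (`|ι|` elements,
  `CMArith.exists_linearIndependent_skew`), so either the rational vectors `(Tr(y_i X))_i`, `X ∈ 𝔤`, span `ℚ^{|ι|}` — then
  the square matrix `(σ_k(y_i))` maps `trv(𝔤_ℂ)` onto `ℂ^{|ι|}`, hence is invertible and `trv(𝔤_ℂ) = ℂ^ι` — or a rational
  functional kills them, giving `y = Σ q_i y_i ≠ 0` with `Tr(y X) = 0` for all `X ∈ 𝔤`, in particular (complexifying)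
  `Tr(y_ℂ Θ) = 2 Σ_k σ_k(y) tr(Θ|_{W_{μ k}}) = 0`.
* **`CMThetaCentre.centre_of_single`** — the case used by the rows with ONE non-balanced place (`dim W_{μ k}^{1,0} =
  dim W_{μ k}^{0,1}` for all `k ≠ k₀`, `≠` at `k₀`; e.g. the sextic pattern `(n_σ) = (2,1,1)`): the second alternative would
  give `σ_{k₀}(y) = 0`, impossible for `y ≠ 0` in the field `E`; so CENTRE holds outright.
(«`Hg(A) = U_F(1) · SU`-type statements: the centre of `Hg` is the subtorus of `U_F(1)` cut out by the reflex norms»,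
Moonen–Zarhin §1–2; Ribet's Thm. 0 `Hg = U_E` when the CM type is non-degenerate.)

## References
* [MoonenZarhin1999LowDim] B. Moonen, Yu. Zarhin, Math. Ann. 315 (1999), §1 (1.8), §2 (2.3).
* [Ribet1983] K. A. Ribet, Amer. J. Math. 105 (1983), Thm. 0 and §3.
* [Deligne1982HodgeCycles] P. Deligne, LNM 900 (1982), I §3 Prop. 3.4, §4 (p. 30), §5 (Ex. 5.?: the centre of `MT` of a CM
  abelian variety and the reflex norm).
-/

noncomputable section

open scoped TensorProduct
open Module

namespace Literature.AlgebraicGeometry.Motives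

namespace HodgeStructure

universe u

variable {V : Type u} [AddCommGroup V] [Module ℚ V] {n : ℤ}

/-- `ℚ[φ]` is commutative: Hodge endomorphisms that are polynomials in `φ` commute. [cite: MoonenZarhin1999LowDim, §1] -/
theorem CMThetaCentre.mul_comm_of_hE (H : HodgeStructure V n) {φ : Module.End ℚ V} {m : ℕ}
    (hE : ∀ a ∈ H.endAlg, ∃ q : Fin m → ℚ, a = ∑ k, q k • φ ^ (k : ℕ)) {a b : Module.End ℚ V} (ha : a ∈ H.endAlg)
    (hb : b ∈ H.endAlg) : a * b = b * a := by
  obtain ⟨q, rfl⟩ := hE a ha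
  obtain ⟨r, rfl⟩ := hE b hb
  rw [Finset.sum_mul, Finset.mul_sum]
  refine Finset.sum_congr rfl fun k _ => ?_
  rw [Finset.mul_sum, Finset.sum_mul]
  refine Finset.sum_congr rfl fun l _ => ?_
  rw [smul_mul_smul_comm, smul_mul_smul_comm, ← pow_add, ← pow_add, add_comm, mul_comm (q k) (r l)]

/-- Rational scalars act on `V_ℂ` through `ℚ ⊆ ℂ`. [folklore] -/
private theorem CMThetaCentre.ratCast_smul (q : ℚ) (z : ℂ ⊗[ℚ] V) : (q : ℂ) • z = q • z := by
  rw [← algebraMap_smul ℂ q z, eq_ratCast]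

variable [Module.Finite ℚ V]

omit [Module.Finite ℚ V] in
/-- The base change of a `ψ`-skew rational endomorphism is `ψ_ℂ`-skew. [cite: Deligne1982HodgeCycles, I §3 (proof of Prop. 3.4)] -/
theorem CMThetaCentre.baseChange_skew (H : HodgeStructure V n) (ψ : H.Polarization) {a : Module.End ℚ V}
    (ha : ∀ v w, ψ.form (a v) w + ψ.form v (a w) = 0) (x y : ℂ ⊗[ℚ] V) :
    ψ.form.baseChange ℂ (a.baseChange ℂ x) y + ψ.form.baseChange ℂ x (a.baseChange ℂ y) = 0 :=
  ThetaSubalgebra.formBaseChange_add_eq_zero_of_mem_spanC ψ (𝔤 := ℚ ∙ a)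
    (fun X hX v w => by
      obtain ⟨c, rfl⟩ := Submodule.mem_span_singleton.1 hX
      rw [LinearMap.smul_apply, LinearMap.smul_apply, map_smul, LinearMap.smul_apply, map_smul, smul_eq_mul,
        smul_eq_mul, ← mul_add, ha, mul_zero])
    (baseChange_mem_spanC (Submodule.mem_span_singleton_self a)) x y

/-- `Tr_ℂ(a_ℂ D)` vanishes on `𝔤_ℂ` when `Tr_ℚ(a X) = 0` for all `X ∈ 𝔤`. [cite: Deligne1982HodgeCycles, I §3 (proof of Prop. 3.4)] -/
theorem CMThetaCentre.trace_mul_eq_zero_of_mem_spanC {a : Module.End ℚ V} {𝔤 : Submodule ℚ (Module.End ℚ V)}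
    (ha : ∀ X ∈ 𝔤, LinearMap.trace ℚ V (a * X) = 0) {D : Module.End ℂ (ℂ ⊗[ℚ] V)} (hD : D ∈ spanC 𝔤) :
    LinearMap.trace ℂ _ (a.baseChange ℂ * D) = 0 := by
  haveI : Module.Free ℚ V := Module.Free.of_divisionRing ℚ V
  unfold spanC at hD
  induction hD using Submodule.span_induction with
  | mem D hD =>
    obtain ⟨X, hX, rfl⟩ := hD
    rw [← LinearMap.baseChange_mul, LinearMap.trace_baseChange, ha X hX, map_zero]
  | zero => rw [mul_zero, map_zero]
  | add D D' _ _ h h' => rw [mul_add, map_add, h, h', add_zero]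
  | smul c D _ h => rw [mul_smul_comm, map_smul, h, smul_zero]

/-- **THE DICHOTOMY «CENTRE, OR A SKEW `y ∈ E` TRACE-ORTHOGONAL TO `𝔤`»** (see the module docstring).
[cite: MoonenZarhin1999LowDim, §2 (2.3)] [cite: Ribet1983, Thm. 0] [cite: Deligne1982HodgeCycles, §4 (p. 30)] -/
theorem CMThetaCentre.centre_or_exists_skew [HodgeTensorFacts.{u, u}] {ι : Type} [Fintype ι] [DecidableEq ι]
    (H : HodgeStructure V n) (hn : n = 1) (heff : H.IsEffective) (ψ : H.Polarization)
    {φ : Module.End ℚ V} (hφE : φ ∈ H.endAlg) {m : ℕ} (hE : ∀ a ∈ H.endAlg, ∃ q : Fin m → ℚ, a = ∑ k, q k • φ ^ (k : ℕ))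
    (hEdim : Module.finrank ℚ H.endAlg = 2 * Fintype.card ι)
    (hdiv : ∀ a ∈ H.endAlg, a ≠ 0 → ∃ b : Module.End ℚ V, b * a = 1) (hφadj : ψ.adjoint φ ≠ φ)
    (μ : ι → ℂ) (hinj : Function.Injective μ) (hdist : ∀ k k', μ k' ≠ starRingEnd ℂ (μ k)) {n₀ : ℕ} (hn₀ : n₀ ≠ 0)
    (hrank : ∀ k, Module.finrank ℂ ↥(Module.End.eigenspace (φ.baseChange ℂ) (μ k) ⊓ H.piece 1 0) +
      Module.finrank ℂ ↥(Module.End.eigenspace (φ.baseChange ℂ) (μ k) ⊓ H.piece 0 1) = n₀)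
    (htop : (⨆ kt : ι × Fin 2, Module.End.eigenspace (φ.baseChange ℂ)
      (if kt.2 = 0 then μ kt.1 else starRingEnd ℂ (μ kt.1))) = ⊤)
    (𝔤 : Submodule ℚ (Module.End ℚ V))
    (hcomm : ∀ X ∈ 𝔤, ∀ a : H.endAlg, X * (a : Module.End ℚ V) = (a : Module.End ℚ V) * X)
    (hskew : ∀ X ∈ 𝔤, ∀ v w, ψ.form (X v) w + ψ.form v (X w) = 0)
    {Θ : Module.End ℂ (ℂ ⊗[ℚ] V)} (hΘ : ∀ p, ∀ x ∈ H.piece p (n - p), Θ x = ((2 * p - n : ℤ) : ℂ) • x)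
    (hΘ𝔤 : Θ ∈ spanC 𝔤)
    (hlift : ∀ k, ∀ Z : Module.End ℂ ↥(Module.End.eigenspace (φ.baseChange ℂ) (μ k)),
      LinearMap.trace ℂ _ Z = 0 → ∃ X ∈ spanC 𝔤,
        (∀ w : ↥(Module.End.eigenspace (φ.baseChange ℂ) (μ k)), X w = Z w) ∧
        ∀ j, j ≠ k → ∀ w ∈ Module.End.eigenspace (φ.baseChange ℂ) (μ j), X w = 0) :
    (∀ k, ∃ C ∈ spanC 𝔤, (∀ w ∈ Module.End.eigenspace (φ.baseChange ℂ) (μ k), C w = w) ∧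
        ∀ j, j ≠ k → ∀ w ∈ Module.End.eigenspace (φ.baseChange ℂ) (μ j), C w = 0) ∨
    ∃ y ∈ H.endAlg, y ≠ 0 ∧ (∀ v w, ψ.form (y v) w + ψ.form v (y w) = 0) ∧
      ∃ τ : ι → ℂ, (∀ k, ∀ w ∈ Module.End.eigenspace (φ.baseChange ℂ) (μ k), y.baseChange ℂ w = τ k • w) ∧
        ∑ k, τ k * ((Module.finrank ℂ ↥(Module.End.eigenspace (φ.baseChange ℂ) (μ k) ⊓ H.piece 1 0) : ℂ) -
          (Module.finrank ℂ ↥(Module.End.eigenspace (φ.baseChange ℂ) (μ k) ⊓ H.piece 0 1) : ℂ)) = 0 := by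
  classical
  subst hn
  set F := φ.baseChange ℂ with hF
  set ψC := ψ.form.baseChange ℂ with hψC
  -- elements of `𝔤_ℂ`: commute with `φ_ℂ`, `ψ_ℂ`-skew, preserve the `W_{μ k}`
  have hDφ : ∀ D ∈ spanC 𝔤, D * F = F * D := fun D hD => UnitaryTheta.commute_of_mem_spanC H hφE hcomm hD
  have hDskew : ∀ D ∈ spanC 𝔤, ∀ x y, ψC (D x) y + ψC x (D y) = 0 := fun D hD =>
    ThetaSubalgebra.formBaseChange_add_eq_zero_of_mem_spanC ψ hskew hD
  have hDW : ∀ D ∈ spanC 𝔤, ∀ k, ∀ w ∈ Module.End.eigenspace F (μ k), D w ∈ Module.End.eigenspace F (μ k) :=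
    fun D hD k w hw => UnitaryTheta.apply_mem_eigenspace_of_commute (hDφ D hD) hw
  -- the adapted dual basis and the coordinate traces
  obtain ⟨cb, κ, hcbW, -, -, -, hdual, hiso⟩ :=
    CMTheta.exists_adaptedDualBasis H rfl heff ψ hφE hE μ hinj hdist hrank htop
  have hfin : ∀ k, Module.finrank ℂ ↥(Module.End.eigenspace F (μ k)) = n₀ := fun k => by
    rw [hF, CMTheta.finrank_eigenspace_eq_add H rfl heff hφE, hrank k]
  have he0 : ∀ k : ι, Function.Injective (fun j : Fin n₀ => (((k, (0 : Fin 2)), j) : (ι × Fin 2) × Fin n₀)) :=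
    fun k j j' h => by simpa using h
  have htrres : ∀ D (hD : D ∈ spanC 𝔤) k,
      LinearMap.trace ℂ _ (D.restrict (hDW D hD k)) = ∑ j, cb.repr (D (cb ((k, 0), j))) ((k, 0), j) :=
    fun D hD k => CMArith.trace_restrict_eq_sum_repr cb _ (he0 k) _ (hcbW k) (hfin k) D (hDW D hD k)
  -- the trace pairing with a skew Hodge endomorphism acting by scalars `σ k` on the `W_{μ k}`
  have hpair : ∀ a ∈ H.endAlg, (∀ v w, ψ.form (a v) w + ψ.form v (a w) = 0) → ∀ σ : ι → ℂ,
      (∀ k, ∀ w ∈ Module.End.eigenspace F (μ k), a.baseChange ℂ w = σ k • w) → ∀ D ∈ spanC 𝔤,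
      LinearMap.trace ℂ _ (a.baseChange ℂ * D) = 2 * ∑ k, σ k * ∑ j, cb.repr (D (cb ((k, 0), j))) ((k, 0), j) :=
    fun a _ haskew σ hσ D hD =>
      CMArith.trace_mul_eq_two_mul_sum cb ψC hdual hiso _ D σ (fun k j => hσ k _ (hcbW k j))
        (CMThetaCentre.baseChange_skew H ψ haskew) (hDskew D hD) (fun k j => hσ k _ (hDW D hD k _ (hcbW k j)))
  -- CENTRE from elements with prescribed coordinate traces, via LIFT
  have hbuild : (∀ k, ∃ D ∈ spanC 𝔤, ∀ i, ∑ j, cb.repr (D (cb ((i, 0), j))) ((i, 0), j) =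
      if i = k then (n₀ : ℂ) else 0) →
      ∀ k, ∃ C ∈ spanC 𝔤, (∀ w ∈ Module.End.eigenspace F (μ k), C w = w) ∧
        ∀ j, j ≠ k → ∀ w ∈ Module.End.eigenspace F (μ j), C w = 0 := by
    intro h k
    obtain ⟨D, hD, hDtr⟩ := h k
    -- lift the traceless parts of `D|_{W_{μ i}}`
    have hZ : ∀ i, ∃ X ∈ spanC 𝔤, (∀ w ∈ Module.End.eigenspace F (μ i),
        X w = D w - ((n₀ : ℂ)⁻¹ * (if i = k then (n₀ : ℂ) else 0)) • w) ∧
        ∀ j, j ≠ i → ∀ w ∈ Module.End.eigenspace F (μ j), X w = 0 := by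
      intro i
      set Di := D.restrict (hDW D hD i) with hDi
      have hn₀' : (Module.finrank ℂ ↥(Module.End.eigenspace F (μ i)) : ℂ) ≠ 0 := by
        rw [hfin]; exact_mod_cast hn₀
      obtain ⟨X, hX, hXi, hXj⟩ := hlift i _ (CMArith.trace_sub_smul_one_eq_zero hn₀' Di)
      refine ⟨X, hX, fun w hw => ?_, hXj⟩
      have h := hXi ⟨w, hw⟩
      rw [h, LinearMap.sub_apply, LinearMap.smul_apply, Module.End.one_apply, Submodule.coe_sub, Submodule.coe_smul,
        hDi, LinearMap.coe_restrict_apply, htrres D hD i, hDtr i, hfin]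
    choose X hX hXi hXj using hZ
    refine ⟨D - ∑ i, X i, Submodule.sub_mem _ hD (Submodule.sum_mem _ fun i _ => hX i), fun w hw => ?_,
      fun j hj w hw => ?_⟩
    · rw [LinearMap.sub_apply, LinearMap.sum_apply, Finset.sum_eq_single k
        (fun i _ hik => hXj i k (Ne.symm hik) w hw) (fun h => absurd (Finset.mem_univ k) h), hXi k w hw, if_pos rfl,
        inv_mul_cancel₀ (by exact_mod_cast hn₀ : (n₀ : ℂ) ≠ 0), one_smul, sub_sub_cancel]
    · rw [LinearMap.sub_apply, LinearMap.sum_apply, Finset.sum_eq_single j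
        (fun i _ hij => hXj i j (Ne.symm hij) w hw) (fun h => absurd (Finset.mem_univ j) h), hXi j w hw, if_neg hj,
        mul_zero, zero_smul, sub_zero, sub_self]
  -- a `ℚ`-basis of `E⁻`
  have hEcomm : ∀ a ∈ H.endAlg, ∀ b ∈ H.endAlg, a * b = b * a := fun a ha b hb =>
    CMThetaCentre.mul_comm_of_hE H hE ha hb
  have hsE : φ - ψ.adjoint φ ∈ H.endAlg := sub_mem hφE (ψ.adjoint_mem_endAlg hφE)
  have hs0 : φ - ψ.adjoint φ ≠ 0 := fun h => hφadj (sub_eq_zero.1 h).symm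
  have hsskew : ∀ v w, ψ.form ((φ - ψ.adjoint φ) v) w + ψ.form v ((φ - ψ.adjoint φ) w) = 0 := fun v w => by
    rw [LinearMap.sub_apply, LinearMap.sub_apply, map_sub, LinearMap.sub_apply, map_sub,
      ψ.isAdjointPair_adjoint_left φ v w, ψ.form_apply_adjoint]
    ring
  obtain ⟨y, hyind, hyE, hyskew⟩ :=
    CMArith.exists_linearIndependent_skew H ψ hEcomm hdiv hEdim hsE hs0 hsskew
  choose τ hτ using fun i k => CMTheta.exists_smul_of_mem_endAlg H hE (hyE i) (μ k)
  -- the rational trace vectors `(Tr(y_i X))_i`, `X ∈ 𝔤`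
  let rL : Module.End ℚ V →ₗ[ℚ] (Fin (Fintype.card ι) → ℚ) :=
    LinearMap.pi fun i => (LinearMap.trace ℚ V) ∘ₗ LinearMap.mulLeft ℚ (y i)
  have hrL : ∀ X i, rL X i = LinearMap.trace ℚ V (y i * X) := fun X i => by
    simp only [rL, LinearMap.pi_apply, LinearMap.comp_apply, LinearMap.mulLeft_apply]
  haveI : Module.Free ℚ V := Module.Free.of_divisionRing ℚ V
  have hrLC : ∀ X ∈ 𝔤, ∀ i, ((rL X i : ℚ) : ℂ) =
      2 * ∑ k, τ i k * ∑ j, cb.repr (X.baseChange ℂ (cb ((k, 0), j))) ((k, 0), j) := fun X hX i => by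
    rw [hrL, ← hpair (y i) (hyE i) (hyskew i) (τ i) (hτ i) _ (baseChange_mem_spanC hX), ← LinearMap.baseChange_mul,
      LinearMap.trace_baseChange, eq_ratCast]
  by_cases hQ : 𝔤.map rL = ⊤
  · /- CASE 1: the rational trace vectors span `ℚ^{|ι|}` ⟹ the matrix `(σ_k(y_i))` maps `trv(𝔤_ℂ)` onto `ℂ^{|ι|}`, so it is
       invertible and `trv(𝔤_ℂ) = ℂ^ι` ⟹ CENTRE -/
    left
    apply hbuild
    let trvL : Module.End ℂ (ℂ ⊗[ℚ] V) →ₗ[ℂ] (ι → ℂ) :=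
      LinearMap.pi fun k => ∑ j : Fin n₀, (cb.coord ((k, 0), j)) ∘ₗ LinearMap.applyₗ (cb ((k, 0), j))
    have htrvL : ∀ D k, trvL D k = ∑ j, cb.repr (D (cb ((k, 0), j))) ((k, 0), j) := fun D k => by
      simp only [trvL, LinearMap.pi_apply, LinearMap.sum_apply, LinearMap.comp_apply, LinearMap.applyₗ_apply_apply,
        Module.Basis.coord_apply]
    let ML : (ι → ℂ) →ₗ[ℂ] (Fin (Fintype.card ι) → ℂ) :=
      LinearMap.pi fun i => ∑ k, τ i k • LinearMap.proj k
    have hML : ∀ v i, ML v i = ∑ k, τ i k * v k := fun v i => by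
      simp only [ML, LinearMap.pi_apply, LinearMap.sum_apply, LinearMap.smul_apply, LinearMap.proj_apply,
        smul_eq_mul]
    -- `ML (trv X_ℂ) = ½ (Tr(y_i X))_i`
    have hMLX : ∀ X ∈ 𝔤, ML (trvL (X.baseChange ℂ)) = fun i => (2 : ℂ)⁻¹ * ((rL X i : ℚ) : ℂ) := fun X hX => by
      funext i
      rw [hML, hrLC X hX i]
      simp_rw [htrvL]
      rw [← mul_assoc, inv_mul_cancel₀ (two_ne_zero : (2 : ℂ) ≠ 0), one_mul]
    -- the image `R'` of `𝔤_ℂ` under `ML ∘ trv` is everything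
    set R' : Submodule ℂ (Fin (Fintype.card ι) → ℂ) := (spanC 𝔤).map (ML ∘ₗ trvL) with hR'
    have hbasis : ∀ i, (fun j => if j = i then (1 : ℂ) else 0) ∈ R' := by
      intro i
      have hv : (Pi.single i (2 : ℚ) : Fin (Fintype.card ι) → ℚ) ∈ 𝔤.map rL := by rw [hQ]; exact Submodule.mem_top
      obtain ⟨X, hX, hXv⟩ := Submodule.mem_map.1 hv
      refine Submodule.mem_map.2 ⟨X.baseChange ℂ, baseChange_mem_spanC hX, ?_⟩
      rw [LinearMap.comp_apply, hMLX X hX]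
      funext j
      rw [hXv, Pi.single_apply]
      split_ifs <;> push_cast <;> ring
    have hR'top : R' = ⊤ := by
      rw [eq_top_iff]
      intro v _
      rw [pi_eq_sum_univ v]
      refine Submodule.sum_mem _ fun i _ => Submodule.smul_mem _ _ ?_
      have h := hbasis i
      convert h using 2 with j
      simp only [eq_comm]
    -- hence `ML` is surjective, hence injective
    have hMLsurj : Function.Surjective ML := fun v => by
      have hv : v ∈ R' := by rw [hR'top]; exact Submodule.mem_top
      obtain ⟨D, -, hDv⟩ := Submodule.mem_map.1 hv
      exact ⟨trvL D, hDv⟩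
    have hMLinj : Function.Injective ML :=
      (LinearMap.injective_iff_surjective_of_finrank_eq_finrank
        (by rw [Module.finrank_fintype_fun_eq_card, Module.finrank_fintype_fun_eq_card, Fintype.card_fin])).2 hMLsurj
    -- and every `n₀ e_k` is a coordinate trace vector of some `D ∈ 𝔤_ℂ`
    intro k
    have hv : ML (Pi.single k (n₀ : ℂ)) ∈ R' := by rw [hR'top]; exact Submodule.mem_top
    obtain ⟨D, hD, hDv⟩ := Submodule.mem_map.1 hv
    refine ⟨D, hD, fun i => ?_⟩
    have h := congrFun (hMLinj hDv) i
    rw [htrvL, Pi.single_apply] at h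
    exact h
  · /- CASE 2: a rational functional kills the trace vectors ⟹ `y = Σ q_i y_i ≠ 0` is trace-orthogonal to `𝔤` -/
    right
    obtain ⟨g, hg0, hg⟩ := Submodule.exists_le_ker_of_lt_top _ (lt_top_iff_ne_top.2 hQ)
    set q : Fin (Fintype.card ι) → ℚ := fun i => g (fun j => if i = j then 1 else 0) with hq
    have hgq : ∀ x, g x = ∑ i, x i * q i := fun x => by
      rw [LinearMap.pi_apply_eq_sum_univ g x]
      simp only [hq, smul_eq_mul]
    set y₀ : Module.End ℚ V := ∑ i, q i • y i with hy₀
    have hy₀E : y₀ ∈ H.endAlg := Subalgebra.sum_mem _ fun i _ => H.endAlg.smul_mem (hyE i) _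
    have hy₀skew : ∀ v w, ψ.form (y₀ v) w + ψ.form v (y₀ w) = 0 := fun v w => by
      rw [hy₀, LinearMap.sum_apply, LinearMap.sum_apply, map_sum, map_sum, LinearMap.sum_apply,
        ← Finset.sum_add_distrib]
      refine Finset.sum_eq_zero fun i _ => ?_
      rw [LinearMap.smul_apply, LinearMap.smul_apply, map_smul, map_smul, LinearMap.smul_apply, smul_eq_mul,
        smul_eq_mul, ← mul_add, hyskew, mul_zero]
    have hy₀0 : y₀ ≠ 0 := by
      intro h
      have hq0 : ∀ i, q i = 0 := Fintype.linearIndependent_iff.1 hyind q (by rw [← hy₀, h])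
      exact hg0 (LinearMap.ext fun x => by rw [hgq, LinearMap.zero_apply]; simp [hq0])
    have hy₀tr : ∀ X ∈ 𝔤, LinearMap.trace ℚ V (y₀ * X) = 0 := fun X hX => by
      have h : g (rL X) = 0 := hg (Submodule.mem_map_of_mem hX)
      rw [hgq] at h
      rw [hy₀, Finset.sum_mul, map_sum, ← h]
      refine Finset.sum_congr rfl fun i _ => ?_
      rw [smul_mul_assoc, map_smul, smul_eq_mul, hrL, mul_comm]
    obtain hσ := fun k => CMTheta.exists_smul_of_mem_endAlg H hE hy₀E (μ k)
    choose σ hσ using hσ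
    refine ⟨y₀, hy₀E, hy₀0, hy₀skew, σ, hσ, ?_⟩
    -- `Σ_k σ_k (dim W^{1,0} − dim W^{0,1}) = Σ_k σ_k tr(Θ|_{W_{μ k}}) = ½ Tr(y_ℂ Θ) = 0`
    have hΘW := hDW Θ hΘ𝔤
    have h2 := hpair y₀ hy₀E hy₀skew σ hσ Θ hΘ𝔤
    rw [CMThetaCentre.trace_mul_eq_zero_of_mem_spanC hy₀tr hΘ𝔤] at h2
    have h3 : ∑ k, σ k * ∑ j, cb.repr (Θ (cb ((k, 0), j))) ((k, 0), j) = 0 := by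
      have := h2.symm
      rwa [mul_eq_zero, or_iff_right (two_ne_zero : (2 : ℂ) ≠ 0)] at this
    rw [← h3]
    refine Finset.sum_congr rfl fun k _ => ?_
    rw [← htrres Θ hΘ𝔤 k, CMArith.trace_restrict_theta H rfl heff hΘ (hΘW k)]

/-- **CENTRE when exactly one place is unbalanced** (`dim W_{μ k}^{1,0} = dim W_{μ k}^{0,1}` for `k ≠ k₀`, `≠` at `k₀`; the
sextic CM pattern `(n_σ) = (2,1,1)` of the cell's row 12, and every `(…, n₀/2, …)`-pattern with one exception): the second
alternative of `centre_or_exists_skew` would read `σ_{k₀}(y) · (dim W_{μ k₀}^{1,0} − dim W_{μ k₀}^{0,1}) = 0`, i.e.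
`σ_{k₀}(y) = 0`, impossible for a non-zero element of the field `E` (`CMArith.apply_ne_zero`). Hence for every `k` some
`C ∈ 𝔤_ℂ` is `1` on `W_{μ k}` and `0` on the other `W_{μ j}` — with LIFT, `𝔤_ℂ ⊇ 𝔲_E(V,ψ)_ℂ`
(`CMThetaSocket.mem_spanC_of_lift_of_centre`). [cite: MoonenZarhin1999LowDim, §2 (2.3)] [cite: Ribet1983, Thm. 0] -/
theorem CMThetaCentre.centre_of_single [HodgeTensorFacts.{u, u}] {ι : Type} [Fintype ι] [DecidableEq ι]
    (H : HodgeStructure V n) (hn : n = 1) (heff : H.IsEffective) (ψ : H.Polarization)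
    {φ : Module.End ℚ V} (hφE : φ ∈ H.endAlg) {m : ℕ} (hE : ∀ a ∈ H.endAlg, ∃ q : Fin m → ℚ, a = ∑ k, q k • φ ^ (k : ℕ))
    (hEdim : Module.finrank ℚ H.endAlg = 2 * Fintype.card ι)
    (hdiv : ∀ a ∈ H.endAlg, a ≠ 0 → ∃ b : Module.End ℚ V, b * a = 1) (hφadj : ψ.adjoint φ ≠ φ)
    (μ : ι → ℂ) (hinj : Function.Injective μ) (hdist : ∀ k k', μ k' ≠ starRingEnd ℂ (μ k)) {n₀ : ℕ} (hn₀ : n₀ ≠ 0)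
    (hrank : ∀ k, Module.finrank ℂ ↥(Module.End.eigenspace (φ.baseChange ℂ) (μ k) ⊓ H.piece 1 0) +
      Module.finrank ℂ ↥(Module.End.eigenspace (φ.baseChange ℂ) (μ k) ⊓ H.piece 0 1) = n₀)
    (htop : (⨆ kt : ι × Fin 2, Module.End.eigenspace (φ.baseChange ℂ)
      (if kt.2 = 0 then μ kt.1 else starRingEnd ℂ (μ kt.1))) = ⊤)
    (𝔤 : Submodule ℚ (Module.End ℚ V))
    (hcomm : ∀ X ∈ 𝔤, ∀ a : H.endAlg, X * (a : Module.End ℚ V) = (a : Module.End ℚ V) * X)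
    (hskew : ∀ X ∈ 𝔤, ∀ v w, ψ.form (X v) w + ψ.form v (X w) = 0)
    {Θ : Module.End ℂ (ℂ ⊗[ℚ] V)} (hΘ : ∀ p, ∀ x ∈ H.piece p (n - p), Θ x = ((2 * p - n : ℤ) : ℂ) • x)
    (hΘ𝔤 : Θ ∈ spanC 𝔤)
    (hlift : ∀ k, ∀ Z : Module.End ℂ ↥(Module.End.eigenspace (φ.baseChange ℂ) (μ k)),
      LinearMap.trace ℂ _ Z = 0 → ∃ X ∈ spanC 𝔤,
        (∀ w : ↥(Module.End.eigenspace (φ.baseChange ℂ) (μ k)), X w = Z w) ∧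
        ∀ j, j ≠ k → ∀ w ∈ Module.End.eigenspace (φ.baseChange ℂ) (μ j), X w = 0)
    (k₀ : ι) (hbal : ∀ k, k ≠ k₀ → Module.finrank ℂ ↥(Module.End.eigenspace (φ.baseChange ℂ) (μ k) ⊓ H.piece 1 0) =
      Module.finrank ℂ ↥(Module.End.eigenspace (φ.baseChange ℂ) (μ k) ⊓ H.piece 0 1))
    (hk₀ : Module.finrank ℂ ↥(Module.End.eigenspace (φ.baseChange ℂ) (μ k₀) ⊓ H.piece 1 0) ≠
      Module.finrank ℂ ↥(Module.End.eigenspace (φ.baseChange ℂ) (μ k₀) ⊓ H.piece 0 1)) :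
    ∀ k, ∃ C ∈ spanC 𝔤, (∀ w ∈ Module.End.eigenspace (φ.baseChange ℂ) (μ k), C w = w) ∧
      ∀ j, j ≠ k → ∀ w ∈ Module.End.eigenspace (φ.baseChange ℂ) (μ j), C w = 0 := by
  classical
  rcases CMThetaCentre.centre_or_exists_skew H hn heff ψ hφE hE hEdim hdiv hφadj μ hinj hdist hn₀ hrank htop 𝔤 hcomm
    hskew hΘ hΘ𝔤 hlift with h | ⟨y, hyE, hy0, -, τ, hτ, hsum⟩
  · exact h
  · exfalso
    rw [Finset.sum_eq_single k₀ (fun k _ hk => by rw [hbal k hk, sub_self, mul_zero])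
      (fun h => absurd (Finset.mem_univ k₀) h), mul_eq_zero, sub_eq_zero, Nat.cast_inj] at hsum
    have hτ0 : τ k₀ = 0 := hsum.resolve_right hk₀
    -- a non-zero vector of `W_{μ k₀}` is killed by `y_ℂ`: contradiction
    have hW : Module.End.eigenspace (φ.baseChange ℂ) (μ k₀) ≠ ⊥ := by
      intro h
      have hfin : Module.finrank ℂ ↥(Module.End.eigenspace (φ.baseChange ℂ) (μ k₀)) = n₀ := by
        rw [CMTheta.finrank_eigenspace_eq_add H hn heff hφE, hrank k₀]
      rw [h, finrank_bot] at hfin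
      exact hn₀ hfin.symm
    obtain ⟨w, hw, hw0⟩ := (Submodule.ne_bot_iff _).1 hW
    exact CMArith.apply_ne_zero H hdiv hyE hy0 hw0 (by rw [hτ k₀ w hw, hτ0, zero_smul])

end HodgeStructure

end Literature.AlgebraicGeometry.Motives
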